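import Summits.QuantumFields.YangMills.Theses.ThermodynamicCeilings

/-!
# Route `ThermodynamicCeilings` — the spectral PAIRING identity (support for the pair spectral representation, step 4)

D-0145 ideator seat ym-idea-11 (g5).  Step 4 of `rep_plan.md` (evidence on items 27771/27776): after the two-insertion trace formula
(`Literature.Analysis.OperatorTheory.hasSum_integral_iterate_insert_two{,_succ}`) the un-normalised pair correlation on a time circle of
`N` bonds is the double spectral sum `S(t) = Σ_{(i,j)} λ_j^t λ_i^{N-t} M_{ij}` with `λ ≥ 0` the transfer-operator eigenvalues and
`M_{ij} = M_{ji} ≥ 0` the squared matrix elements.  PAIRING `(i,j)` with `(j,i)` turns it, for `1 ≤ t ≤ N-1`, into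
`S(t) = Σ_p d_p + Σ_p w_p (e^{-E_p t} + e^{-E_p (N-t)})` with the t-INDEPENDENT degenerate part `d_p = [λ_i = λ_j] λ_i^N M_{ij}`,
weights `w_p = [0 < λ_j < λ_i] λ_i^N M_{ij} ≥ 0` and gaps `E_p = log(λ_i/λ_j) > 0` (dummy `1` off the pair set) — exactly the input of
`exists_measure_of_hasSum_pairProfile` (discrete spectral measure file).  Pure Mathlib (tsum algebra); closes nothing;
no summit / leaf / NT / UV / IR statement is proved.
-/

namespace Summit.QuantumFields.YangMills.Cruxes.MirrorMonotoneDecay.SpectralPairing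

open Real

variable {ι : Type*}

/-- for `0 < b < a` and naturals `t`: `e^{-log(a/b)·t} = (b/a)^t`. -/
theorem exp_neg_log_mul (a b : ℝ) (ha : 0 < a) (hb : 0 < b) (t : ℕ) :
    Real.exp (-(Real.log (a / b) * t)) = (b / a) ^ t := by
  have h : -(Real.log (a / b) * t) = (t : ℝ) * Real.log (b / a) := by
    rw [Real.log_div ha.ne' hb.ne', Real.log_div hb.ne' ha.ne']; ring
  rw [h, Real.exp_nat_mul, Real.exp_log (div_pos hb ha)]

/-- `λ_j^t λ_i^{N-t} ≤ λ_i^N + λ_j^N` for `0 ≤ λ`, `t ≤ N` (domination used for summability). -/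
theorem pow_mul_pow_le_add (x y : ℝ) (hx : 0 ≤ x) (hy : 0 ≤ y) (N t : ℕ) (ht : t ≤ N) :
    y ^ t * x ^ (N - t) ≤ x ^ N + y ^ N := by
  have hm1 : y ^ t ≤ (max x y) ^ t := pow_le_pow_left₀ hy (le_max_right _ _) t
  have hm2 : x ^ (N - t) ≤ (max x y) ^ (N - t) := pow_le_pow_left₀ hx (le_max_left _ _) _
  have hmN : (max x y) ^ t * (max x y) ^ (N - t) = (max x y) ^ N := by rw [← pow_add, Nat.add_sub_cancel' ht]
  have h1 : y ^ t * x ^ (N - t) ≤ (max x y) ^ N := by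
    rw [← hmN]; exact mul_le_mul hm1 hm2 (by positivity) (by positivity)
  rcases le_total x y with h | h
  · rw [max_eq_right h] at h1; linarith [pow_nonneg hx N]
  · rw [max_eq_left h] at h1; linarith [pow_nonneg hy N]

/-- **The pointwise pairing identity.**  With `d, w, E` as in the module docstring, for every ordered pair `p = (i,j)` and `1 ≤ t ≤ N-1`:
`λ_j^t λ_i^{N-t} M_{ij} = d_p + w_p e^{-E_p t} + w_{p.swap} e^{-E_{p.swap} (N-t)}`. -/
theorem pairing_pointwise (lam : ι → ℝ) (M : ι → ι → ℝ) (hl0 : ∀ i, 0 ≤ lam i) (hsym : ∀ i j, M i j = M j i)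
    (N t : ℕ) (ht : 1 ≤ t) (htN : t + 1 ≤ N) (i j : ι) :
    lam j ^ t * lam i ^ (N - t) * M i j =
      (if lam i = lam j then lam i ^ N * M i j else 0) +
      (if 0 < lam j ∧ lam j < lam i then lam i ^ N * M i j else 0) *
          Real.exp (-((if 0 < lam j ∧ lam j < lam i then Real.log (lam i / lam j) else 1) * t)) +
      (if 0 < lam i ∧ lam i < lam j then lam j ^ N * M j i else 0) *
          Real.exp (-((if 0 < lam i ∧ lam i < lam j then Real.log (lam j / lam i) else 1) * ((N : ℝ) - t))) := by
  have htN' : t ≤ N := by omega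
  have hNt : 1 ≤ N - t := by omega
  have hcast : ((N : ℝ) - t) = ((N - t : ℕ) : ℝ) := by rw [Nat.cast_sub htN']
  rcases lt_trichotomy (lam j) (lam i) with hlt | heq | hgt
  · -- λ_j < λ_i
    have hne : ¬ lam i = lam j := fun h => by rw [h] at hlt; exact lt_irrefl _ hlt
    have hno : ¬ (0 < lam i ∧ lam i < lam j) := fun h => lt_asymm hlt h.2
    rw [if_neg hne, if_neg hno, if_neg hno, zero_add, zero_mul, add_zero]
    by_cases hj : 0 < lam j
    · have hi : 0 < lam i := lt_trans hj hlt
      rw [if_pos ⟨hj, hlt⟩, if_pos ⟨hj, hlt⟩, exp_neg_log_mul _ _ hi hj t]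
      have : lam i ^ N = lam i ^ t * lam i ^ (N - t) := by rw [← pow_add, Nat.add_sub_cancel' htN']
      rw [this, div_pow]
      field_simp
    · have hj0 : lam j = 0 := le_antisymm (not_lt.1 hj) (hl0 j)
      have hno' : ¬ (0 < lam j ∧ lam j < lam i) := fun h => hj h.1
      rw [if_neg hno', zero_mul, hj0, zero_pow (by omega), zero_mul, zero_mul]
  · -- λ_j = λ_i
    have hno1 : ¬ (0 < lam j ∧ lam j < lam i) := fun h => by rw [heq] at h; exact lt_irrefl _ h.2
    have hno2 : ¬ (0 < lam i ∧ lam i < lam j) := fun h => by rw [heq] at h; exact lt_irrefl _ h.2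
    rw [if_pos heq.symm, if_neg hno1, if_neg hno2, zero_mul, zero_mul, add_zero, add_zero, heq, ← pow_add,
      Nat.add_sub_cancel' htN']
  · -- λ_i < λ_j : the mirrored term
    have hne : ¬ lam i = lam j := fun h => by rw [h] at hgt; exact lt_irrefl _ hgt
    have hno : ¬ (0 < lam j ∧ lam j < lam i) := fun h => lt_asymm hgt h.2
    rw [if_neg hne, if_neg hno, if_neg hno, zero_add, zero_mul, zero_add]
    by_cases hi : 0 < lam i
    · have hj : 0 < lam j := lt_trans hi hgt
      rw [if_pos ⟨hi, hgt⟩, if_pos ⟨hi, hgt⟩, hcast, exp_neg_log_mul _ _ hj hi (N - t), ← hsym i j]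
      have : lam j ^ N = lam j ^ t * lam j ^ (N - t) := by rw [← pow_add, Nat.add_sub_cancel' htN']
      rw [this, div_pow]
      field_simp
    · have hi0 : lam i = 0 := le_antisymm (not_lt.1 hi) (hl0 i)
      have hno' : ¬ (0 < lam i ∧ lam i < lam j) := fun h => hi h.1
      rw [if_neg hno', zero_mul, hi0, zero_pow (by omega), mul_zero, zero_mul]

/-- **THE PAIRING IDENTITY (summed).**  For `λ ≥ 0`, `M` symmetric and non-negative with `Σ_{(i,j)} λ_i^N M_{ij} < ∞`, and
`1 ≤ t ≤ N - 1`: the weights `w_p = [0 < λ_j < λ_i] λ_i^N M_{ij}` are `≥ 0` and summable, the gaps `E_p` (`log(λ_i/λ_j)` on the pair set,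
`1` off it) are `> 0`, the degenerate part `d` is summable, and
`Σ_{(i,j)} λ_j^t λ_i^{N-t} M_{ij} = Σ_p d_p + Σ_p w_p (e^{-E_p t} + e^{-E_p (N - t)})` as a `HasSum`. -/
theorem hasSum_pairing (lam : ι → ℝ) (M : ι → ι → ℝ) (hl0 : ∀ i, 0 ≤ lam i) (hM0 : ∀ i j, 0 ≤ M i j)
    (hsym : ∀ i j, M i j = M j i) (N t : ℕ) (ht : 1 ≤ t) (htN : t + 1 ≤ N)
    (hs : Summable fun p : ι × ι => lam p.1 ^ N * M p.1 p.2)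
    (w E d : ι × ι → ℝ)
    (hw : ∀ p, w p = if 0 < lam p.2 ∧ lam p.2 < lam p.1 then lam p.1 ^ N * M p.1 p.2 else 0)
    (hE : ∀ p, E p = if 0 < lam p.2 ∧ lam p.2 < lam p.1 then Real.log (lam p.1 / lam p.2) else 1)
    (hd : ∀ p, d p = if lam p.1 = lam p.2 then lam p.1 ^ N * M p.1 p.2 else 0) :
    (∀ p, 0 ≤ w p) ∧ (∀ p, 0 < E p) ∧ Summable w ∧ Summable d ∧
      HasSum (fun p : ι × ι => lam p.2 ^ t * lam p.1 ^ (N - t) * M p.1 p.2)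
        (∑' p, d p + ∑' p, w p * (Real.exp (-(E p * t)) + Real.exp (-(E p * ((N : ℝ) - t))))) := by
  set G : ι × ι → ℝ := fun p => lam p.1 ^ N * M p.1 p.2 with hG
  have hG0 : ∀ p, 0 ≤ G p := fun p => mul_nonneg (pow_nonneg (hl0 _) _) (hM0 _ _)
  have hw0 : ∀ p, 0 ≤ w p := fun p => by rw [hw]; split_ifs <;> [exact hG0 p; exact le_rfl]
  have hwle : ∀ p, w p ≤ G p := fun p => by rw [hw]; split_ifs <;> [exact le_rfl; exact hG0 p]
  have hd0 : ∀ p, 0 ≤ d p := fun p => by rw [hd]; split_ifs <;> [exact hG0 p; exact le_rfl]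
  have hdle : ∀ p, d p ≤ G p := fun p => by rw [hd]; split_ifs <;> [exact le_rfl; exact hG0 p]
  have hEpos : ∀ p, 0 < E p := fun p => by
    rw [hE]; split_ifs with h
    · exact Real.log_pos (by rw [lt_div_iff₀ h.1, one_mul]; exact h.2)
    · exact one_pos
  have hsw : Summable w := Summable.of_nonneg_of_le hw0 hwle hs
  have hsd : Summable d := Summable.of_nonneg_of_le hd0 hdle hs
  -- the swapped weight family is summable too (reindex by `Equiv.prodComm`)
  have hGs : Summable fun p : ι × ι => G p.swap :=
    (Equiv.prodComm ι ι).summable_iff.mpr hs |>.congr fun p => rfl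
  have hexp1 : ∀ p, Real.exp (-(E p * t)) ≤ 1 := fun p =>
    Real.exp_le_one_iff.mpr (by nlinarith [hEpos p, (Nat.cast_nonneg t : (0:ℝ) ≤ t)])
  have hNt : (0:ℝ) ≤ (N : ℝ) - t := by
    have : (t : ℝ) ≤ N := by exact_mod_cast (show t ≤ N by omega)
    linarith
  have hexp2 : ∀ p, Real.exp (-(E p * ((N : ℝ) - t))) ≤ 1 := fun p =>
    Real.exp_le_one_iff.mpr (by nlinarith [hEpos p])
  -- the three summable pieces
  have hs1 : Summable fun p => w p * Real.exp (-(E p * t)) :=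
    Summable.of_nonneg_of_le (fun p => mul_nonneg (hw0 p) (Real.exp_pos _).le)
      (fun p => (mul_le_of_le_one_right (hw0 p) (hexp1 p)).trans (hwle p)) hs
  have hs2' : Summable fun p : ι × ι => w p.swap * Real.exp (-(E p.swap * ((N : ℝ) - t))) :=
    Summable.of_nonneg_of_le (fun p => mul_nonneg (hw0 _) (Real.exp_pos _).le)
      (fun p => (mul_le_of_le_one_right (hw0 _) (hexp2 _)).trans (hwle _)) hGs
  have hs2 : Summable fun p : ι × ι => w p * Real.exp (-(E p * ((N : ℝ) - t))) :=
    Summable.of_nonneg_of_le (fun p => mul_nonneg (hw0 _) (Real.exp_pos _).le)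
      (fun p => (mul_le_of_le_one_right (hw0 _) (hexp2 _)).trans (hwle _)) hs
  -- the swapped sum equals the unswapped one
  have hswap : ∑' p : ι × ι, w p.swap * Real.exp (-(E p.swap * ((N : ℝ) - t))) =
      ∑' p : ι × ι, w p * Real.exp (-(E p * ((N : ℝ) - t))) :=
    (Equiv.prodComm ι ι).tsum_eq (fun p : ι × ι => w p * Real.exp (-(E p * ((N : ℝ) - t))))
  -- pointwise identity
  have hpt : ∀ p : ι × ι, lam p.2 ^ t * lam p.1 ^ (N - t) * M p.1 p.2 =
      d p + w p * Real.exp (-(E p * t)) + w p.swap * Real.exp (-(E p.swap * ((N : ℝ) - t))) := by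
    rintro ⟨i, j⟩
    rw [hd, hw, hE, hw, hE]
    simp only [Prod.swap_prod_mk]
    exact pairing_pointwise lam M hl0 hsym N t ht htN i j
  refine ⟨hw0, hEpos, hsw, hsd, ?_⟩
  have hsum : HasSum (fun p : ι × ι => d p + w p * Real.exp (-(E p * t)) + w p.swap * Real.exp (-(E p.swap * ((N : ℝ) - t))))
      (∑' p, d p + ∑' p, w p * Real.exp (-(E p * t)) + ∑' p : ι × ι, w p.swap * Real.exp (-(E p.swap * ((N : ℝ) - t)))) :=
    (hsd.hasSum.add hs1.hasSum).add hs2'.hasSum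
  rw [hswap] at hsum
  have e : ∑' p, d p + ∑' p, w p * (Real.exp (-(E p * t)) + Real.exp (-(E p * ((N : ℝ) - t)))) =
      ∑' p, d p + ∑' p, w p * Real.exp (-(E p * t)) + ∑' p : ι × ι, w p * Real.exp (-(E p * ((N : ℝ) - t))) := by
    rw [add_assoc, ← hs1.tsum_add hs2]
    congr 1; exact tsum_congr fun p => by ring
  rw [e]
  have hfeq : (fun p : ι × ι => lam p.2 ^ t * lam p.1 ^ (N - t) * M p.1 p.2) =
      fun p => d p + w p * Real.exp (-(E p * t)) + w p.swap * Real.exp (-(E p.swap * ((N : ℝ) - t))) := funext hpt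
  rw [hfeq]
  exact hsum

end Summit.QuantumFields.YangMills.Cruxes.MirrorMonotoneDecay.SpectralPairing
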